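import Literature.NumberTheory.GaloisRepresentations.HeckeCharacterInfinityTypeNormTwistProofs
import Literature.NumberTheory.EllipticCurves.KatzPAdicLFunctionCMField
import HarnessLib

/-!
# The entire-continuation binder `hL` of the Katz–Hida–Tilouine frames (`KatzCM.IsMeasure` / `IsLine` /
# `IsBaseChangeLine`) is AUTOMATIC for characters of Katz type `kΣ + κ(1 − c)`, `k ≥ 1`, on a totally complex
# (e.g. CM) field (Tate 1950, Thm. 4.4.1, through the infinity type)

Topic `NumberTheory/EllipticCurves` (companion proof file of `KatzPAdicLFunctionCMField.lean`, Hsieh Crelle 688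
Prop. 4.9 frames), namespace `Literature.NumberTheory.EllipticCurves` / `KatzCM`. PROOFS ONLY (no definition, no named
fact, no `sorry`). The frames prescribe a value at a character `χ = λρ` of the typed range only together with an
entire continuation `hL : LFunction.HasEntireContinuation (heckeLFunction χ)`; this file shows such an `hL` EXISTS
for every `χ` with `KatzCM.HasKatzType ι Σ_p χ k κ`, `k ≥ 1`, granted that at one infinite place `w₀` exactly one of
the two complex embeddings lies in the CM type `Σ` cut out by `Σ_p` (`KatzCM.InSigma`; automatic for a genuine CM type):
there `{p_{w₀}, q_{w₀}} = {−(k + κ_{w₀}), κ_{w₀}}`, so `p ≠ q` and `p + q = −k ≤ 0`, and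
`HeckeCharacter.hasEntireContinuation_heckeLFunction_of_hasInfinityType` (sequel files
`HeckeLFunctionEntireContinuationShiftProofs`, `HeckeCharacterInfinityTypeNormTwistProofs`: Tate's theorem for the
unitary part, the exponent `σ = k/2 ≥ 0` read off the type, non-norm-twist from `p ≠ q`) applies. Requested by route
`BiquadraticEisensteinDescent` of `Summits/BirchSwinnertonDyer` (hypothesis (C) of
`…EisensteinHeartFlatCMInertBadKPrimeKatzHsiehDisplay.display_relation`, which thereby follows from the Katz-type
hypothesis (T) alone). Nothing about any case of BSD is asserted.

References: [Hsieh2014mu] Prop. 4.9 (§4.8), §4.1 (the type `kΣ + κ(1−c)`, `k ≥ 1`); [TateThesis1967] Thm. 4.4.1;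
[Weil1956] §1.
-/

noncomputable section

open scoped NumberField ComplexConjugate

namespace Literature.NumberTheory.EllipticCurves

open Literature.NumberTheory.GaloisRepresentations NumberField InfinitePlace IsDedekindDomain

/-- **The continuation binder of the Katz frames is automatic**: on a totally complex `L`, a Hecke character of
Katz type `kΣ + κ(1 − c)` with `k ≥ 1` (`KatzCM.HasKatzType ι Σ_p χ k κ`) has an `L`-function with entire
continuation, provided at ONE infinite place `w₀` exactly one of `σ_{w₀}`, `σ̄_{w₀}` lies in `Σ` (automatic for the CM
type cut out by a `p`-adic CM type): there `{p_{w₀}, q_{w₀}} = {−(k+κ_{w₀}), κ_{w₀}}`, so `p ≠ q`, `p + q = −k ≤ 0`,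
and `HeckeCharacter.hasEntireContinuation_heckeLFunction_of_hasInfinityType` applies.
[cite: Hsieh2014mu, Prop. 4.9 (§4.8)] [cite: TateThesis1967, Thm. 4.4.1] -/
theorem KatzCM.hasEntireContinuation_of_hasKatzType {L : Type} [Field L] [NumberField L] [IsTotallyComplex L]
    {p : ℕ} [Fact p.Prime] {ι : PadicAlgCl p ≃+* ℂ} {Sp : Finset (HeightOneSpectrum (𝓞 L))} {χ : HeckeCharacter L}
    {k : ℕ} {κ : InfinitePlace L → ℕ} (hT : KatzCM.HasKatzType ι Sp χ k κ) (hk : 1 ≤ k) (w₀ : InfinitePlace L)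
    (hx : KatzCM.InSigma ι Sp w₀.embedding ↔ ¬ KatzCM.InSigma ι Sp (ComplexEmbedding.conjugate w₀.embedding)) :
    LFunction.HasEntireContinuation (heckeLFunction χ) := by
  classical
  have hw₀ : ¬ w₀.IsReal := not_isReal_iff_isComplex.mpr (IsTotallyComplex.isComplex w₀)
  have hp : (HeckeCharacter.typeOfExponent (KatzCM.katzExponent ι Sp k κ)).1 w₀ =
      (if KatzCM.InSigma ι Sp w₀.embedding then -((k : ℤ) + κ w₀) else (κ w₀ : ℤ)) := by
    simp only [HeckeCharacter.typeOfExponent, KatzCM.katzExponent, mk_embedding]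
  have hq : (HeckeCharacter.typeOfExponent (KatzCM.katzExponent ι Sp k κ)).2 w₀ =
      (if KatzCM.InSigma ι Sp (ComplexEmbedding.conjugate w₀.embedding) then -((k : ℤ) + κ w₀)
        else (κ w₀ : ℤ)) := by
    simp only [HeckeCharacter.typeOfExponent, KatzCM.katzExponent, if_neg hw₀, mk_conjugate_eq, mk_embedding]
  have hk' : (1 : ℤ) ≤ k := by exact_mod_cast hk
  have hκ : (0 : ℤ) ≤ κ w₀ := by exact_mod_cast Nat.zero_le _
  refine HeckeCharacter.hasEntireContinuation_heckeLFunction_of_hasInfinityType hT w₀ ?_ ?_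
  · rw [hp, hq]
    by_cases hσ : KatzCM.InSigma ι Sp w₀.embedding
    · rw [if_pos hσ, if_neg (hx.mp hσ)]; omega
    · rw [if_neg hσ, if_pos (not_not.mp (mt hx.mpr hσ))]; omega
  · rw [hp, hq]
    by_cases hσ : KatzCM.InSigma ι Sp w₀.embedding
    · rw [if_pos hσ, if_neg (hx.mp hσ)]; omega
    · rw [if_neg hσ, if_pos (not_not.mp (mt hx.mpr hσ))]; omega


/-- **For a `p`-adic CM type on a CM field, exactly one of `φ`, `φ̄` lies in the CM type `Σ` it cuts out**: the
`p`-adic place of `ι⁻¹ ∘ φ̄ = (ι⁻¹ ∘ φ) ∘ c` is `c •` that of `ι⁻¹ ∘ φ` (`place_comp_algEquiv`), and a `p`-adic CM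
type contains exactly one of `w`, `c • w` for every `w ∣ p` (`KatzCM.IsPAdicCMType`) — the argument of
`HeckeCharacter.cmExponent_add_cmExponent_conjugate`. [cite: Hsieh2014mu, §1.1 (`Σ_p` and `Σ`, (ord))] -/
theorem KatzCM.inSigma_iff_not_inSigma_conjugate {L : Type} [Field L] [NumberField L] [IsTotallyComplex L]
    [IsCMField L] {p : ℕ} [Fact p.Prime] {ι : PadicAlgCl p ≃+* ℂ} {Sp : Finset (HeightOneSpectrum (𝓞 L))}
    (hSp : KatzCM.IsPAdicCMType p Sp) (φ : L →+* ℂ) :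
    KatzCM.InSigma ι Sp φ ↔ ¬ KatzCM.InSigma ι Sp (ComplexEmbedding.conjugate φ) := by
  set τ : L →+* PadicAlgCl p := (ι.symm : ℂ ≃+* PadicAlgCl p).toRingHom.comp φ with hτ
  have hconj : (ι.symm : ℂ ≃+* PadicAlgCl p).toRingHom.comp (ComplexEmbedding.conjugate φ) =
      τ.comp ((IsCMField.complexConj L : L ≃ₐ[maximalRealSubfield L] L) : L →+* L) := by
    ext x
    change (ι.symm : ℂ ≃+* PadicAlgCl p) (ComplexEmbedding.conjugate φ x) =
      (ι.symm : ℂ ≃+* PadicAlgCl p) (φ (IsCMField.complexConj L x))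
    rw [ComplexEmbedding.conjugate_coe_eq, IsCMField.complexEmbedding_complexConj]
  have hplace : PadicEmbedding.place ((ι.symm : ℂ ≃+* PadicAlgCl p).toRingHom.comp (ComplexEmbedding.conjugate φ)) =
      IsCMField.complexConj L • PadicEmbedding.place τ := by
    rw [hconj, HeckeCharacter.place_comp_algEquiv, HeckeCharacter.complexConj_inv]
  have hℓ : ((p : ℕ) : 𝓞 L) ∈ (PadicEmbedding.place τ).asIdeal := PadicEmbedding.natCast_mem_place τ
  unfold KatzCM.InSigma
  rw [hplace, ← hτ]
  exact hSp.2 _ hℓ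

/-- **The continuation binder of the Katz frames is automatic on a CM field with a `p`-adic CM type**: for `L` CM,
`Σ_p` a `p`-adic CM type (`KatzCM.IsPAdicCMType`) and `χ` of Katz type `kΣ + κ(1 − c)` with `k ≥ 1`
(`KatzCM.HasKatzType ι Σ_p χ k κ`), `L(s, χ)` has an entire continuation — the `hL` of `KatzCM.IsMeasure` /
`IsLine` / `IsBaseChangeLine` at every point of the typed range, with no further hypothesis.
[cite: Hsieh2014mu, Prop. 4.9 (§4.8), §1.1, §4.1] [cite: TateThesis1967, Thm. 4.4.1] -/
theorem KatzCM.hasEntireContinuation_of_hasKatzType_of_isPAdicCMType {L : Type} [Field L] [NumberField L]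
    [IsTotallyComplex L] [IsCMField L] {p : ℕ} [Fact p.Prime] {ι : PadicAlgCl p ≃+* ℂ}
    {Sp : Finset (HeightOneSpectrum (𝓞 L))} (hSp : KatzCM.IsPAdicCMType p Sp) {χ : HeckeCharacter L} {k : ℕ}
    {κ : InfinitePlace L → ℕ} (hT : KatzCM.HasKatzType ι Sp χ k κ) (hk : 1 ≤ k) :
    LFunction.HasEntireContinuation (heckeLFunction χ) :=
  let w₀ : InfinitePlace L := Classical.arbitrary _
  KatzCM.hasEntireContinuation_of_hasKatzType hT hk w₀ (KatzCM.inSigma_iff_not_inSigma_conjugate hSp _)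

end Literature.NumberTheory.EllipticCurves

end
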